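import Mathlib.Analysis.Convex.Topology
import Literature.Probability.LatticeModels.WeakBeurlingEstimate
import Literature.Probability.LatticeModels.HarmonicExtension
import Literature.Probability.LatticeModels.LatticeLipschitzPath
import Literature.Probability.LatticeModels.DomainDiscretisation
import HarnessLib

/-!
# Boundary regularity of lattice-harmonic functions on discretised domains, uniformly in the mesh

Topic `Literature/Probability/LatticeModels` (discrete potential theory on `δℤ²`; the boundary
half of the convergence of discrete harmonic functions to continuum ones on the discharge path of
`Kenyon2000_flatEdgePoissonKernelLimit`, Kenyon 2000, §5: "for any region `U` with piecewise
smooth boundary … `H^{P_ε}` converges to a continuous harmonic function `H^U`" — the step where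
boundary values are shown to be taken uniformly in `ε`).

Setting: `Ω ⊆ ℂ` open and bounded satisfying a **uniform exterior quadrant condition** (at every
frontier point some open axis-parallel quadrant of fixed radius `r₀` misses `closure Ω`; proved
for rectilinear Jordan domains in `RandomPlanarGeometry/RectilinearJordanLocalStructure.lean`);
meshes `δₙ → 0`; `Sₙ = {v | δₙ v ∈ closure Ω}`; `Fₙ` lattice harmonic on `Sₙ` with boundary values
`Fₙ(w) = Φ(δₙ w) + o(1)` on the outer boundary, `Φ` continuous at the frontier; `f` continuous
on `closure Ω` with `f = Φ` on the frontier. **Theorem** (`abs_sub_le_near_frontier`): for every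
`ε > 0` there is `ρ > 0` such that eventually `|Fₙ v - f(δₙ v)| ≤ ε` at every `v ∈ Sₙ` within
distance `ρ` of the frontier. Proof: two-constants argument — the harmonic measure of the part of
the outer boundary outside the box `sqBox p R` (`R ≍ r/δₙ`) seen from `v` is small by the weak
Beurling estimate `weakBeurling_of_cutPath` (the cut is a straight lattice path inside the
exterior quadrant at the frontier point nearest to `v`), while on the near part the data are
within `o(1)` of `Φ(ζ')`.

Also proved: straight lattice walks (`exists_straightWalk`), outer boundary sites of `Sₙ` are
within `δₙ` of the frontier (`exists_frontier_dist_le_of_closure`), uniform continuity at a compact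
set (`exists_forall_dist_lt_abs_sub_le`). Everything is proved, [folklore]; no named fact.

## References

* R. Kenyon, *Conformal invariance of domino tiling*, Ann. Probab. 28 (2000), §5 [Kenyon2000].
* G. F. Lawler, V. Limic, *Random Walk: A Modern Introduction* (2010), §6.3, §8.1 [LawlerLimic2010].
* S. Smirnov, Ann. of Math. 172 (2010), Appendix B, Lemma B.2 [Smirnov2010].
-/

noncomputable section

namespace Literature.Probability.LatticeModels

open Set Metric Filter Complex _root_.Topology WeakBeurling Literature.Probability.Percolation

/-! ### Straight lattice walks and their coordinates -/

/-- Coordinates after `i` steps north. [folklore] -/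
theorem add_nsmul_cornerUnit_one_apply' (v : Site 2) (i : ℕ) :
    (v + i • cornerUnit 1) 0 = v 0 ∧ (v + i • cornerUnit 1) 1 = v 1 + i := by
  rw [add_nsmul_cornerUnit_one_eq]; simp

/-- Coordinates after `i` steps south. [folklore] -/
theorem add_nsmul_cornerUnit_three_apply (v : Site 2) (i : ℕ) :
    (v + i • cornerUnit 3) 0 = v 0 ∧ (v + i • cornerUnit 3) 1 = v 1 - i := by
  have h : v + i • cornerUnit 3 = ![v 0, v 1 - i] := by
    ext j; fin_cases j <;> simp [cornerUnit, nsmul_eq_mul, sub_eq_add_neg]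
  rw [h]; simp

/-- **Straight walks**: from `v`, `m` unit steps in the direction `cornerUnit k` form a lattice
walk whose support consists of the sites `v + i • cornerUnit k`, `i ≤ m`. [folklore] -/
theorem exists_straightWalk (v : Site 2) (k : Fin 4) (m : ℕ) :
    ∃ q : (zdGraph 2).Walk v (v + m • cornerUnit k),
      ∀ z ∈ q.support, ∃ i : ℕ, i ≤ m ∧ z = v + i • cornerUnit k := by
  induction m with
  | zero =>
    refine ⟨(SimpleGraph.Walk.nil : (zdGraph 2).Walk v v).copy rfl (by rw [zero_nsmul, add_zero]), ?_⟩
    intro z hz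
    rw [SimpleGraph.Walk.support_copy, SimpleGraph.Walk.support_nil, List.mem_singleton] at hz
    exact ⟨0, le_rfl, by rw [hz, zero_nsmul, add_zero]⟩
  | succ m ih =>
    obtain ⟨q, hq⟩ := ih
    have hadj : (zdGraph 2).Adj (v + m • cornerUnit k) (v + (m + 1) • cornerUnit k) := by
      rw [succ_nsmul, ← add_assoc]
      exact adj_of_stepKind (stepKind_add_cornerUnit _ k)
    refine ⟨q.concat hadj, fun z hz => ?_⟩
    rw [SimpleGraph.Walk.support_concat] at hz
    simp only [List.mem_append, List.mem_singleton] at hz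
    rcases hz with hz | hz
    · obtain ⟨i, hi, rfl⟩ := hq z hz
      exact ⟨i, Nat.le_succ_of_le hi, rfl⟩
    · exact ⟨m + 1, le_rfl, hz⟩

/-! ### Frontier points near segments leaving the closure; uniform continuity at a compact set -/

/-- A preconnected set meeting `A` and `Aᶜ` meets `frontier A`. [folklore] -/
private theorem inter_frontier_nonempty_aux {c A : Set ℂ} (hc : IsPreconnected c)
    (h1 : (c ∩ A).Nonempty) (h2 : (c ∩ Aᶜ).Nonempty) : (c ∩ frontier A).Nonempty := by
  by_contra h
  rw [not_nonempty_iff_eq_empty] at h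
  have hsub : c ⊆ interior A ∪ (closure A)ᶜ := by
    intro z hz
    by_cases hz1 : z ∈ closure A
    · rw [closure_eq_interior_union_frontier] at hz1
      rcases hz1 with h' | h'
      · exact Or.inl h'
      · have : z ∈ c ∩ frontier A := ⟨hz, h'⟩
        rw [h] at this
        exact this.elim
    · exact Or.inr hz1
  have hdisj : Disjoint (interior A) (closure A)ᶜ :=
    Set.disjoint_left.2 fun z hz hz' => hz' (interior_subset_closure hz)
  rcases hc.subset_or_subset isOpen_interior isClosed_closure.isOpen_compl hdisj hsub with h' | h'
  · obtain ⟨z, hz, hz'⟩ := h2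
    exact hz' (interior_subset (h' hz))
  · obtain ⟨z, hz, hz'⟩ := h1
    exact (h' hz) (subset_closure hz')

/-- If `z₁ ∈ closure A` and `z₂ ∉ closure A`, some frontier point of `A` lies on the segment
`[z₁, z₂]`, in particular within `dist z₁ z₂` of both endpoints. [folklore] -/
theorem exists_frontier_dist_le_of_closure {A : Set ℂ} {z₁ z₂ : ℂ} (h1 : z₁ ∈ closure A)
    (h2 : z₂ ∉ closure A) :
    ∃ ζ ∈ frontier A, dist z₁ ζ ≤ dist z₁ z₂ ∧ dist z₂ ζ ≤ dist z₁ z₂ := by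
  have hseg : IsPreconnected (segment ℝ z₁ z₂) := (convex_segment z₁ z₂).isPreconnected
  obtain ⟨ζ, hζs, hζf⟩ := inter_frontier_nonempty_aux (A := closure A) hseg
    ⟨z₁, left_mem_segment ℝ z₁ z₂, h1⟩ ⟨z₂, right_mem_segment ℝ z₁ z₂, h2⟩
  refine ⟨ζ, frontier_closure_subset hζf, ?_, ?_⟩
  · have : ζ ∈ closedBall z₁ (dist z₁ z₂) :=
      (convex_closedBall z₁ (dist z₁ z₂)).segment_subset (mem_closedBall_self dist_nonneg)
        (by rw [mem_closedBall, dist_comm]) hζs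
    rw [mem_closedBall, dist_comm] at this
    exact this
  · have : ζ ∈ closedBall z₂ (dist z₁ z₂) :=
      (convex_closedBall z₂ (dist z₁ z₂)).segment_subset (by rw [mem_closedBall])
        (mem_closedBall_self dist_nonneg) hζs
    rw [mem_closedBall, dist_comm] at this
    exact this

/-- **Uniform continuity at a compact set.** If `Φ` is continuous at every point of a compact set
`K`, then for `ε > 0` there is `r > 0` with `|Φ z - Φ ζ| ≤ ε` whenever `ζ ∈ K` and `dist z ζ < r`
(`z` arbitrary). Lebesgue number of the cover by continuity balls. [folklore] -/
theorem exists_forall_dist_lt_abs_sub_le {K : Set ℂ} (hK : IsCompact K) {Φ : ℂ → ℝ}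
    (hΦ : ∀ ζ ∈ K, ContinuousAt Φ ζ) {ε : ℝ} (hε : 0 < ε) :
    ∃ r > 0, ∀ ζ ∈ K, ∀ z : ℂ, dist z ζ < r → |Φ z - Φ ζ| ≤ ε := by
  -- continuity radii
  have hrad : ∀ ζ : K, ∃ s > 0, ∀ z : ℂ, dist z (ζ : ℂ) < s → |Φ z - Φ ζ| < ε / 2 := by
    intro ζ
    have := Metric.tendsto_nhds.1 (hΦ ζ ζ.2) (ε / 2) (by positivity)
    obtain ⟨s, hs, h⟩ := Metric.eventually_nhds_iff.1 this
    exact ⟨s, hs, fun z hz => h hz⟩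
  choose s hs hball using hrad
  obtain ⟨r, hr, hleb⟩ := lebesgue_number_lemma_of_metric hK (c := fun ζ : K => ball (ζ : ℂ) (s ζ))
    (fun ζ => isOpen_ball) (fun ζ hζ => mem_iUnion.2 ⟨⟨ζ, hζ⟩, mem_ball_self (hs _)⟩)
  refine ⟨r, hr, fun ζ hζ z hz => ?_⟩
  obtain ⟨i, hi⟩ := hleb ζ hζ
  have h1 : |Φ z - Φ i| < ε / 2 := hball i z (mem_ball.1 (hi (mem_ball.2 hz)))
  have h2 : |Φ ζ - Φ i| < ε / 2 := hball i ζ (mem_ball.1 (hi (mem_ball_self hr)))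
  rw [abs_sub_lt_iff] at h1 h2
  rw [abs_le]
  constructor <;> linarith

/-! ### The theorem -/

set_option maxHeartbeats 800000 in
/-- **Boundary values are taken uniformly in the mesh.** Let `Ω` be open and bounded with the
uniform exterior quadrant condition of radius `r₀`; `δₙ > 0`, `δₙ → 0`;
`Sₙ = {v | δₙ v ∈ closure Ω}`; `Fₙ` lattice harmonic on `Sₙ` with
`sup_{∂Sₙ} |Fₙ - Φ ∘ δₙ| → 0`, `Φ` continuous at each frontier point; `f` continuous on
`closure Ω` with `f = Φ` on `frontier Ω`. Then for every `ε > 0` there is `ρ > 0` such that, for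
all large `n`, `|Fₙ v - f (δₙ v)| ≤ ε` for every `v ∈ Sₙ` with `infDist (δₙ v) (frontier Ω) < ρ`.
(Two-constants argument with the weak Beurling estimate; Kenyon 2000, §5, proof of Thm 13 /
Lemma 17, boundary step.) [cite: Kenyon2000, §5.2] -/
theorem abs_sub_le_near_frontier {Ω : Set ℂ} (hΩb : Bornology.IsBounded Ω)
    {r₀ : ℝ} (hr₀ : 0 < r₀)
    (hUEQ : ∀ ζ ∈ frontier Ω, ∃ s₁ s₂ : ℝ, (s₁ = 1 ∨ s₁ = -1) ∧ (s₂ = 1 ∨ s₂ = -1) ∧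
      ∀ z : ℂ, s₁ * ζ.re < s₁ * z.re → s₂ * ζ.im < s₂ * z.im → dist z ζ < r₀ → z ∉ closure Ω)
    {δ : ℕ → ℝ} (hδ : ∀ n, 0 < δ n) (hδ0 : Tendsto δ atTop (𝓝 0))
    {S : ℕ → Set (Site 2)} (hS : ∀ n v, v ∈ S n ↔ meshPoint (δ n) v ∈ closure Ω)
    {F : ℕ → Site 2 → ℝ} (hF : ∀ n, IsLatticeHarmonicOn (F n) (S n))
    {Φ : ℂ → ℝ} (hΦ : ∀ ζ ∈ frontier Ω, ContinuousAt Φ ζ)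
    (hdata : ∀ ε > 0, ∀ᶠ n in atTop, ∀ w ∈ latticeOuterBoundary (S n),
      |F n w - Φ (meshPoint (δ n) w)| ≤ ε)
    {f : ℂ → ℝ} (hf : ContinuousOn f (closure Ω)) (hfΦ : ∀ ζ ∈ frontier Ω, f ζ = Φ ζ)
    {ε : ℝ} (hε : 0 < ε) :
    ∃ ρ > 0, ∀ᶠ n in atTop, ∀ v ∈ S n, infDist (meshPoint (δ n) v) (frontier Ω) < ρ →
      |F n v - f (meshPoint (δ n) v)| ≤ ε := by
  classical
  -- Step 0: compactness constants
  have hKc : IsCompact (frontier Ω) :=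
    Metric.isCompact_of_isClosed_isBounded isClosed_frontier
      (hΩb.closure.subset frontier_subset_closure)
  obtain ⟨r₁, hr₁, hΦu⟩ := exists_forall_dist_lt_abs_sub_le hKc hΦ (show (0 : ℝ) < ε / 8 by positivity)
  obtain ⟨B, hB⟩ : ∃ B, ∀ ζ ∈ frontier Ω, |Φ ζ| ≤ B := by
    obtain ⟨B, hB⟩ := hKc.exists_bound_of_continuousOn (continuousOn_of_forall_continuousAt hΦ)
    exact ⟨B, fun ζ hζ => by simpa [Real.norm_eq_abs] using hB ζ hζ⟩
  have hB0 : ∀ ζ ∈ frontier Ω, 0 ≤ B := fun ζ hζ => (abs_nonneg _).trans (hB ζ hζ)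
  have hcl : IsCompact (closure Ω) := hΩb.isCompact_closure
  obtain ⟨δf, hδf, hfu⟩ := Metric.uniformContinuousOn_iff.1 (hcl.uniformContinuousOn_of_continuous hf)
    (ε / 8) (by positivity)
  -- constants
  set C : ℝ := beurlingConst with hC
  set β : ℝ := beurlingExp with hβ
  have hCpos : 0 < C := beurlingConst_pos
  have hβpos : 0 < β := beurlingExp_pos
  set M₂ : ℝ := 2 * |B| + ε / 8 + 1 with hM₂
  have hM₂0 : 0 ≤ M₂ := by positivity
  set r : ℝ := min r₀ r₁ / 8 with hr
  have hrpos : 0 < r := by positivity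
  have hrr₀ : 8 * r ≤ r₀ := by rw [hr]; linarith [min_le_left r₀ r₁]
  have hrr₁ : 8 * r ≤ r₁ := by rw [hr]; linarith [min_le_right r₀ r₁]
  -- Step 1: choose `ρ`
  have hρev : ∀ᶠ ρ in 𝓝[>] (0 : ℝ), C * M₂ * (7 * ρ / r) ^ β < ε / 8 ∧ ρ < δf ∧ ρ < r := by
    refine (?_ : ∀ᶠ ρ in 𝓝[>] (0 : ℝ), _).and ((?_ : ∀ᶠ ρ in 𝓝[>] (0 : ℝ), _).and ?_)
    · have hcont : Continuous (fun ρ : ℝ => C * M₂ * (7 * ρ / r) ^ β) := by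
        have h1 : Continuous (fun ρ : ℝ => (7 * ρ / r) ^ β) :=
          (by fun_prop : Continuous (fun ρ : ℝ => 7 * ρ / r)).rpow_const fun _ => Or.inr hβpos.le
        exact continuous_const.mul h1
      have hval : (fun ρ : ℝ => C * M₂ * (7 * ρ / r) ^ β) 0 < ε / 8 := by
        simp only [mul_zero, zero_div, Real.zero_rpow hβpos.ne', mul_zero]
        positivity
      have hev := hcont.continuousAt.eventually (Iio_mem_nhds hval)
      exact hev.filter_mono nhdsWithin_le_nhds
    · exact nhdsWithin_le_nhds (Iio_mem_nhds hδf)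
    · exact nhdsWithin_le_nhds (Iio_mem_nhds hrpos)
  obtain ⟨ρ, ⟨hρ1, hρ2, hρ3⟩, hρ0⟩ := (hρev.and self_mem_nhdsWithin).exists
  have hρ0 : 0 < ρ := hρ0
  refine ⟨ρ, hρ0, ?_⟩
  -- Step 2: choose `N`
  have hε81 : 0 < min (ε / 8) 1 := by positivity
  filter_upwards [hdata _ hε81, hδ0.eventually (Iio_mem_nhds hρ0)] with n hdat hδn
  intro v hv hdist
  set d : ℝ := δ n with hd
  have hd0 : 0 < d := hδ n
  have hdρ : d < ρ := hδn
  have hdr : d < r := hdρ.trans hρ3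
  -- the frontier is nonempty
  have hvcl : meshPoint d v ∈ closure Ω := (hS n v).1 hv
  have hfrne : (frontier Ω).Nonempty := by
    by_contra hfe
    rw [not_nonempty_iff_eq_empty] at hfe
    have hclo : IsClosed Ω := by
      rw [← closure_subset_iff_isClosed, closure_eq_self_union_frontier, hfe, union_empty]
    have hop : IsOpen Ω := by
      rw [← interior_eq_iff_isOpen]
      have := closure_eq_interior_union_frontier Ω
      rw [hfe, union_empty, hclo.closure_eq] at this
      exact this.symm
    rcases isClopen_iff.1 ⟨hclo, hop⟩ with h | h
    · rw [h, closure_empty] at hvcl; exact hvcl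
    · exact (NormedSpace.unbounded_univ ℝ ℂ) (h ▸ hΩb)
  -- Step 3: nearest frontier point and its exterior quadrant
  obtain ⟨ζ', hζ', hvζ'⟩ := (Metric.infDist_lt_iff hfrne).1 hdist
  obtain ⟨s₁, s₂, hs₁, hs₂, hQ⟩ := hUEQ ζ' hζ'
  have hs₁sq : s₁ * s₁ = 1 := by rcases hs₁ with h | h <;> rw [h] <;> norm_num
  have hs₂sq : s₂ * s₂ = 1 := by rcases hs₂ with h | h <;> rw [h] <;> norm_num
  have hs₁abs : |s₁| = 1 := by rcases hs₁ with h | h <;> rw [h] <;> norm_num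
  have hs₂abs : |s₂| = 1 := by rcases hs₂ with h | h <;> rw [h] <;> norm_num
  -- the base site `p` of the cut, inside the quadrant
  set z₀ : ℂ := ζ' + (2 * d) * (s₁ + s₂ * I) with hz₀
  set p : Site 2 := nearestSite d z₀ with hp
  have hpz₀ : dist (meshPoint d p) z₀ ≤ d := dist_meshPoint_nearestSite_le hd0 z₀
  have hz₀re : z₀.re = ζ'.re + 2 * d * s₁ := by simp [hz₀]
  have hz₀im : z₀.im = ζ'.im + 2 * d * s₂ := by simp [hz₀]
  have hpre : d ≤ s₁ * ((meshPoint d p).re - ζ'.re) := by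
    have h1 : |(meshPoint d p).re - z₀.re| ≤ d :=
      (abs_re_le_norm (meshPoint d p - z₀)).trans (by rwa [← dist_eq])
    rw [hz₀re, abs_le] at h1
    have : s₁ * ((meshPoint d p).re - ζ'.re) =
        s₁ * ((meshPoint d p).re - (ζ'.re + 2 * d * s₁)) + 2 * d * (s₁ * s₁) := by ring
    rw [this, hs₁sq, mul_one]
    have h2 : -d ≤ s₁ * ((meshPoint d p).re - (ζ'.re + 2 * d * s₁)) := by
      rcases hs₁ with h | h <;> rw [h] at h1 ⊢ <;>
        [linarith [h1.1]; linarith [h1.2]]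
    linarith
  have hpim : d ≤ s₂ * ((meshPoint d p).im - ζ'.im) := by
    have h1 : |(meshPoint d p).im - z₀.im| ≤ d :=
      (abs_im_le_norm (meshPoint d p - z₀)).trans (by rwa [← dist_eq])
    rw [hz₀im, abs_le] at h1
    have : s₂ * ((meshPoint d p).im - ζ'.im) =
        s₂ * ((meshPoint d p).im - (ζ'.im + 2 * d * s₂)) + 2 * d * (s₂ * s₂) := by ring
    rw [this, hs₂sq, mul_one]
    have h2 : -d ≤ s₂ * ((meshPoint d p).im - (ζ'.im + 2 * d * s₂)) := by
      rcases hs₂ with h | h <;> rw [h] at h1 ⊢ <;>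
        [linarith [h1.1]; linarith [h1.2]]
    linarith
  have hpζ' : dist (meshPoint d p) ζ' ≤ 5 * d := by
    have h1 : dist z₀ ζ' ≤ 4 * d := by
      rw [dist_eq, hz₀, add_sub_cancel_left, norm_mul]
      have h2 : ‖(s₁ : ℂ) + s₂ * I‖ ≤ 2 := by
        refine (norm_add_le _ _).trans ?_
        rw [norm_mul, norm_I, mul_one, norm_real, norm_real, Real.norm_eq_abs, Real.norm_eq_abs,
          hs₁abs, hs₂abs]; norm_num
      have h3 : ‖(2 * d : ℂ)‖ = 2 * d := by
        rw [show (2 * d : ℂ) = ((2 * d : ℝ) : ℂ) by push_cast; ring, norm_real, Real.norm_eq_abs,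
          abs_of_pos (by positivity)]
      rw [h3]
      have := mul_le_mul_of_nonneg_left h2 (show (0 : ℝ) ≤ 2 * d by positivity)
      linarith
    linarith [dist_triangle (meshPoint d p) z₀ ζ']
  -- the escape direction `k₂` (north if `s₂ = 1`, south if `s₂ = -1`) and the coordinates along it
  obtain ⟨k₂, hk₂⟩ : ∃ k₂ : Fin 4, ∀ i : ℕ, (p + i • cornerUnit k₂) 0 = p 0 ∧
      (((p + i • cornerUnit k₂) 1 : ℤ) : ℝ) = p 1 + s₂ * i := by
    rcases hs₂ with h | h
    · refine ⟨1, fun i => ⟨(add_nsmul_cornerUnit_one_apply' p i).1, ?_⟩⟩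
      rw [(add_nsmul_cornerUnit_one_apply' p i).2, h]; push_cast; ring
    · refine ⟨3, fun i => ⟨(add_nsmul_cornerUnit_three_apply p i).1, ?_⟩⟩
      rw [(add_nsmul_cornerUnit_three_apply p i).2, h]; push_cast; ring
  have hmesh : ∀ i : ℕ, (meshPoint d (p + i • cornerUnit k₂)).re = (meshPoint d p).re ∧
      (meshPoint d (p + i • cornerUnit k₂)).im = (meshPoint d p).im + s₂ * i * d := by
    intro i
    refine ⟨by rw [meshPoint_re, meshPoint_re, (hk₂ i).1], ?_⟩
    rw [meshPoint_im, meshPoint_im, (hk₂ i).2]; ring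
  -- the cut: `R + 1` steps from `p`, inside the exterior quadrant
  set R : ℕ := ⌊r / d⌋₊ with hR
  have hRle : (R : ℝ) * d ≤ r := by
    have := Nat.floor_le (show 0 ≤ r / d by positivity)
    rw [← hR] at this
    calc (R : ℝ) * d ≤ r / d * d := mul_le_mul_of_nonneg_right this hd0.le
      _ = r := div_mul_cancel₀ r hd0.ne'
  have hRgt : r < ((R : ℝ) + 1) * d := by
    have := Nat.lt_floor_add_one (r / d)
    rw [← hR] at this
    calc r = r / d * d := (div_mul_cancel₀ r hd0.ne').symm
      _ < ((R : ℝ) + 1) * d := mul_lt_mul_of_pos_right this hd0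
  obtain ⟨q, hq⟩ := exists_straightWalk p k₂ (R + 1)
  have hqS : ∀ z ∈ q.support, z ∉ S n := by
    intro z hz hzS
    obtain ⟨i, hi, rfl⟩ := hq z hz
    have hcl' : meshPoint d (p + i • cornerUnit k₂) ∈ closure Ω := (hS n _).1 hzS
    refine hQ _ ?_ ?_ ?_ hcl'
    · rw [(hmesh i).1]
      have := mul_sub s₁ (meshPoint d p).re ζ'.re
      linarith [hpre]
    · rw [(hmesh i).2]
      have : s₂ * ((meshPoint d p).im + s₂ * i * d) = s₂ * (meshPoint d p).im + (s₂ * s₂) * i * d := by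
        ring
      rw [this, hs₂sq, one_mul]
      have : (0 : ℝ) ≤ i * d := by positivity
      have := mul_sub s₂ (meshPoint d p).im ζ'.im
      linarith [hpim]
    · have h1 : dist (meshPoint d (p + i • cornerUnit k₂)) (meshPoint d p) = i * d := by
        rw [dist_eq]
        have : meshPoint d (p + i • cornerUnit k₂) - meshPoint d p = ((s₂ * i * d : ℝ) : ℂ) * I := by
          apply Complex.ext
          · rw [sub_re, (hmesh i).1]; simp
          · rw [sub_im, (hmesh i).2]; simp
        rw [this, norm_mul, norm_I, mul_one, norm_real, Real.norm_eq_abs, abs_mul, abs_mul, hs₂abs,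
          one_mul, abs_of_nonneg (Nat.cast_nonneg i), abs_of_pos hd0]
      have h2 : (i : ℝ) * d ≤ ((R : ℝ) + 1) * d := by
        refine mul_le_mul_of_nonneg_right ?_ hd0.le
        exact_mod_cast hi
      calc dist (meshPoint d (p + i • cornerUnit k₂)) ζ'
          ≤ dist (meshPoint d (p + i • cornerUnit k₂)) (meshPoint d p) + dist (meshPoint d p) ζ' :=
            dist_triangle _ _ _
        _ ≤ ((R : ℝ) + 1) * d + 5 * d := by rw [h1]; linarith
        _ = (R : ℝ) * d + 6 * d := by ring
        _ < r₀ := by linarith [hRle, hdr, hrr₀]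
  have hend : p + (R + 1) • cornerUnit k₂ ∉ sqBox p R := by
    intro h
    rw [mem_sqBox] at h
    have h2 := h.2
    have h3 : (((p + (R + 1) • cornerUnit k₂) 1 : ℤ) : ℝ) = p 1 + s₂ * ((R + 1 : ℕ) : ℝ) := (hk₂ (R + 1)).2
    have h4 : |(((p + (R + 1) • cornerUnit k₂) 1 : ℤ) : ℝ) - p 1| ≤ R := by exact_mod_cast h2
    rw [h3, add_sub_cancel_left, abs_mul, hs₂abs, one_mul] at h4
    push_cast at h4
    rw [abs_of_nonneg (by positivity)] at h4
    linarith
  -- the far harmonic measure and the weak Beurling estimate at `v`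
  have hSfin : (S n).Finite := by
    have := meshVertices_finite (Ω := closure Ω) hΩb.closure hd0
    refine this.subset fun z hz => ?_
    exact (hS n z).1 hz
  set g : Site 2 → ℝ := fun w => if w ∈ sqBox p R then 0 else 1 with hg
  set HM : Site 2 → ℝ := harmExt (S n) g with hHM
  have hHMh : IsLatticeHarmonicOn HM (S n) := harmExt_harmonicOn hSfin g
  have hHMoff : ∀ w ∉ S n, HM w = g w := fun w hw => harmExt_of_not_mem hSfin g hw
  have hg01 : ∀ w, 0 ≤ g w ∧ g w ≤ 1 := fun w => by
    simp only [hg]; split_ifs <;> norm_num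
  set ρ' : ℕ := ⌊ρ / d⌋₊ + 5 with hρ'
  have hvbox : v ∈ sqBox p ρ' := by
    have hpv : dist (meshPoint d p) (meshPoint d v) < ρ + 5 * d := by
      linarith [dist_triangle (meshPoint d p) ζ' (meshPoint d v), dist_comm (meshPoint d v) ζ']
    have hfl : ρ / d < (⌊ρ / d⌋₊ : ℝ) + 1 := Nat.lt_floor_add_one _
    have key : ∀ t : ℤ, d * |(t : ℝ)| ≤ dist (meshPoint d p) (meshPoint d v) → |t| ≤ (ρ' : ℤ) := by
      intro t ht
      have h1 : d * |(t : ℝ)| < ρ + 5 * d := ht.trans_lt hpv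
      have h2 : |(t : ℝ)| < ρ / d + 5 := by
        rw [div_add' _ _ _ hd0.ne', lt_div_iff₀ hd0]; linarith
      have h3 : |(t : ℝ)| < (⌊ρ / d⌋₊ : ℝ) + 1 + 5 := by linarith
      have h4 : ((|t| : ℤ) : ℝ) < ((⌊ρ / d⌋₊ + 5 : ℕ) : ℝ) + 1 := by
        rw [Int.cast_abs]; push_cast; linarith
      have h5 : (|t| : ℤ) < ((⌊ρ / d⌋₊ + 5 : ℕ) : ℤ) + 1 := by exact_mod_cast h4
      exact Int.lt_add_one_iff.1 h5
    rw [mem_sqBox]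
    constructor
    · refine key (v 0 - p 0) ?_
      have := mul_abs_sub_le_dist_meshPoint_zero d hd0.le p v
      push_cast
      exact this
    · refine key (v 1 - p 1) ?_
      have := mul_abs_sub_le_dist_meshPoint_one d hd0.le p v
      push_cast
      exact this
  have hBeur : HM v ≤ C * (((ρ' : ℝ) + 1) / ((R : ℝ) + 1)) ^ β :=
    weakBeurling_of_cutPath hSfin hHMh
      (fun w hw => by rw [hHMoff w hw.1]; exact (hg01 w).2)
      (fun w hw hwb => by rw [hHMoff w hw.1]; simp only [hg]; exact if_pos hwb)
      q hend hqS hv hvbox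
  have hratio : ((ρ' : ℝ) + 1) / ((R : ℝ) + 1) ≤ 7 * ρ / r := by
    have h1 : ((ρ' : ℝ) + 1) ≤ ρ / d + 6 := by
      rw [hρ']; push_cast; linarith [Nat.floor_le (show 0 ≤ ρ / d by positivity)]
    have h2 : r / d < (R : ℝ) + 1 := by rwa [div_lt_iff₀ hd0]
    have h3 : 0 < r / d := by positivity
    calc ((ρ' : ℝ) + 1) / ((R : ℝ) + 1) ≤ (ρ / d + 6) / (r / d) :=
          div_le_div₀ (by positivity) h1 h3 h2.le
      _ = (ρ + 6 * d) / r := by field_simp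
      _ ≤ 7 * ρ / r := div_le_div_of_nonneg_right (by linarith) hrpos.le
  have hHMv : HM v ≤ C * (7 * ρ / r) ^ β := by
    refine hBeur.trans (mul_le_mul_of_nonneg_left ?_ hCpos.le)
    exact Real.rpow_le_rpow (by positivity) hratio hβpos.le
  have hHMv' : M₂ * HM v ≤ ε / 8 := by
    have h1 := mul_le_mul_of_nonneg_left hHMv hM₂0
    have h2 : M₂ * (C * (7 * ρ / r) ^ β) = C * M₂ * (7 * ρ / r) ^ β := by ring
    linarith
  -- Step 4: boundary comparison data
  set c₀ : ℝ := Φ ζ' with hc₀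
  have hc₀B : |c₀| ≤ |B| := (hB ζ' hζ').trans (le_abs_self B)
  have hbdry : ∀ w ∈ latticeOuterBoundary (S n), |F n w - c₀| ≤ ε / 4 + M₂ * g w := by
    intro w hw
    obtain ⟨hwS, v', hv'S, k, rfl⟩ := hw
    have hv'cl : meshPoint d v' ∈ closure Ω := (hS n v').1 hv'S
    have hwcl : meshPoint d (v' + cornerUnit k) ∉ closure Ω := fun h => hwS ((hS n _).2 h)
    -- a frontier point within `d` of `δ w`
    have hstep : dist (meshPoint d v') (meshPoint d (v' + cornerUnit k)) = d := by
      have hsq : dist (meshPoint d v') (meshPoint d (v' + cornerUnit k)) ^ 2 = d ^ 2 := by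
        rw [dist_meshPoint_sq, meshPoint_re, meshPoint_im]
        rcases coord_step_of_stepKind (stepKind_add_cornerUnit v' k) with
          ⟨h0, h1⟩ | ⟨h0, h1⟩ | ⟨h0, h1⟩ | ⟨h0, h1⟩
        · rw [h0, h1]; push_cast; ring
        · rw [h0, h1]; push_cast; ring
        · rw [h0, h1]; push_cast; ring
        · rw [h0, h1]; push_cast; ring
      have h := (sq_eq_sq₀ dist_nonneg hd0.le).1 hsq
      exact h
    obtain ⟨ζ'', hζ'', -, hwζ''⟩ := exists_frontier_dist_le_of_closure hv'cl hwcl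
    rw [hstep] at hwζ''
    have hΦw : |Φ (meshPoint d (v' + cornerUnit k)) - Φ ζ''| ≤ ε / 8 :=
      hΦu ζ'' hζ'' _ (lt_of_le_of_lt hwζ'' (by linarith))
    have hFw : |F n (v' + cornerUnit k) - Φ (meshPoint d (v' + cornerUnit k))| ≤ min (ε / 8) 1 :=
      hdat _ ⟨hwS, v', hv'S, k, rfl⟩
    have hFw1 := hFw.trans (min_le_left _ _)
    have hFw2 := hFw.trans (min_le_right _ _)
    by_cases hwb : v' + cornerUnit k ∈ sqBox p R
    · -- near part: `δ w` is within `r₁` of `ζ'`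
      have hg0 : g (v' + cornerUnit k) = 0 := by simp only [hg]; exact if_pos hwb
      rw [hg0, mul_zero, add_zero]
      have hwp : dist (meshPoint d (v' + cornerUnit k)) (meshPoint d p) ≤ 2 * r := by
        rw [mem_sqBox] at hwb
        have e0 : |(((v' + cornerUnit k) 0 : ℤ) : ℝ) - p 0| ≤ R := by exact_mod_cast hwb.1
        have e1 : |(((v' + cornerUnit k) 1 : ℤ) : ℝ) - p 1| ≤ R := by exact_mod_cast hwb.2
        rw [dist_eq]
        refine (norm_le_abs_re_add_abs_im _).trans ?_
        rw [sub_re, sub_im, meshPoint_re, meshPoint_re, meshPoint_im, meshPoint_im, ← mul_sub, ← mul_sub,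
          abs_mul, abs_mul, abs_of_pos hd0]
        have f0 := mul_le_mul_of_nonneg_left e0 hd0.le
        have f1 := mul_le_mul_of_nonneg_left e1 hd0.le
        have : d * (R : ℝ) = R * d := mul_comm _ _
        linarith
      have hwζ' : dist (meshPoint d (v' + cornerUnit k)) ζ' < r₁ := by
        have := dist_triangle (meshPoint d (v' + cornerUnit k)) (meshPoint d p) ζ'
        linarith [hpζ', hdr, hrr₁]
      have h3 : |Φ (meshPoint d (v' + cornerUnit k)) - c₀| ≤ ε / 8 := hΦu ζ' hζ' _ hwζ'
      calc |F n (v' + cornerUnit k) - c₀|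
          ≤ |F n (v' + cornerUnit k) - Φ (meshPoint d (v' + cornerUnit k))| +
            |Φ (meshPoint d (v' + cornerUnit k)) - c₀| := abs_sub_le _ _ _
        _ ≤ ε / 8 + ε / 8 := add_le_add hFw1 h3
        _ = ε / 4 := by ring
    · -- far part
      have hg1 : g (v' + cornerUnit k) = 1 := by simp only [hg]; exact if_neg hwb
      rw [hg1, mul_one]
      have h1 : |Φ (meshPoint d (v' + cornerUnit k))| ≤ |B| + ε / 8 := by
        have := abs_sub_abs_le_abs_sub (Φ (meshPoint d (v' + cornerUnit k))) (Φ ζ'')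
        linarith [hB ζ'' hζ'', le_abs_self B]
      have h2 : |F n (v' + cornerUnit k)| ≤ |B| + ε / 8 + 1 := by
        have := abs_sub_abs_le_abs_sub (F n (v' + cornerUnit k)) (Φ (meshPoint d (v' + cornerUnit k)))
        linarith
      calc |F n (v' + cornerUnit k) - c₀| ≤ |F n (v' + cornerUnit k)| + |c₀| := abs_sub _ _
        _ ≤ (|B| + ε / 8 + 1) + |B| := add_le_add h2 hc₀B
        _ ≤ ε / 4 + M₂ := by rw [hM₂]; linarith
  -- Step 5: the comparison principle, twice
  have hsuper : IsLatticeSuperharmonicOn (fun w => M₂ * HM w) (S n) := by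
    intro w hw
    rw [latticeLaplacian_const_mul, hHMh w hw, mul_zero]
  have hsub1 : IsLatticeSubharmonicOn (fun w => F n w - c₀) (S n) := by
    intro w hw
    rw [show (fun w => F n w - c₀) = (F n) + fun _ => -c₀ by funext; simp [sub_eq_add_neg],
      latticeLaplacian_add, latticeLaplacian_const, hF n w hw, add_zero]
  have hsub2 : IsLatticeSubharmonicOn (fun w => c₀ - F n w) (S n) := by
    intro w hw
    rw [show (fun w => c₀ - F n w) = (-(F n)) + fun _ => c₀ by funext; simp [sub_eq_neg_add],
      latticeLaplacian_add, latticeLaplacian_neg, latticeLaplacian_const, hF n w hw, neg_zero, add_zero]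
  have hb1 : ∀ w ∈ latticeOuterBoundary (S n), (fun w => F n w - c₀) w ≤ (fun w => M₂ * HM w) w + ε / 4 := by
    intro w hw
    have h := hbdry w hw
    show F n w - c₀ ≤ M₂ * HM w + ε / 4
    rw [hHMoff w hw.1]
    linarith [(abs_le.1 h).2]
  have hb2 : ∀ w ∈ latticeOuterBoundary (S n), (fun w => c₀ - F n w) w ≤ (fun w => M₂ * HM w) w + ε / 4 := by
    intro w hw
    have h := hbdry w hw
    show c₀ - F n w ≤ M₂ * HM w + ε / 4
    rw [hHMoff w hw.1]
    have := (abs_le.1 h).1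
    linarith
  have hup : F n v - c₀ ≤ M₂ * HM v + ε / 4 := le_of_sub_super_of_boundary hSfin hsub1 hsuper hb1 v hv
  have hdown : c₀ - F n v ≤ M₂ * HM v + ε / 4 :=
    le_of_sub_super_of_boundary hSfin hsub2 hsuper hb2 v hv
  -- Step 6: conclusion
  have hfv : |f (meshPoint d v) - c₀| ≤ ε / 8 := by
    rw [hc₀, ← hfΦ ζ' hζ']
    have := hfu (meshPoint d v) hvcl ζ' (frontier_subset_closure hζ') (hvζ'.trans hρ2)
    rw [Real.dist_eq] at this
    exact this.le
  have hFv : |F n v - c₀| ≤ ε / 8 + ε / 4 := by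
    rw [abs_le]; constructor <;> linarith
  calc |F n v - f (meshPoint d v)| ≤ |F n v - c₀| + |c₀ - f (meshPoint d v)| := abs_sub_le _ _ _
    _ ≤ (ε / 8 + ε / 4) + ε / 8 := add_le_add hFv (by rw [abs_sub_comm]; exact hfv)
    _ ≤ ε := by linarith

end Literature.Probability.LatticeModels
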